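import Summits.BirchSwinnertonDyer.Rank1Residual.X11b.RungK2Leaves
import Summits.BirchSwinnertonDyer.Rank1Residual.X11b.HalvesReceptacle
import Summits.BirchSwinnertonDyer.Rank1Residual.X11b.Three.StepLHalves
import Literature.NumberTheory.EllipticCurves.BDPAnticyclotomicPAdicLFunction
import Summits.BirchSwinnertonDyer.BirchSwinnertonDyer.Theses.ErratumRoadFive
import Summits.BirchSwinnertonDyer.BirchSwinnertonDyer.Theorems.ErratumRoadFiveControlFromJSWMult
import Summits.BirchSwinnertonDyer.BirchSwinnertonDyer.Theorems.ClassRecordThreeStepLOfHalvesB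
import Summits.BirchSwinnertonDyer.BirchSwinnertonDyer.Theorems.ErratumRoadFiveRest3TorsionBranchB
import Summits.BirchSwinnertonDyer.BirchSwinnertonDyer.Theorems.ErratumRoadFiveKernelLowerHalfRamFree
import Summits.BirchSwinnertonDyer.BirchSwinnertonDyer.Theorems.ErratumRoadFiveOpenInputNotRamRung6615d1

/-!
# BC3 birth skeleton — crux `ErratumRoadFive.OpenInputNotRamRamFree` (the RAM-FREE re-cut «19282‡» of the (¬ram) atom 19282 `OpenInputNotRam`;
# minted by planner RULING 107, 2026-08-29; = `closes` binder `hOff` after the RULING 86 (c) re-key)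
# v1 (bsd-stepL-imc-p1 g34, 2026-08-29, planner RULING 107 ask (T2); TURNKEY, NOT KEYED — W-79): 19282's registered `Lines/birth.lean` v4
# (5681fbf9ed21ea68, imc-p1 g29 ∕ plan g44 RULING 93∕95) RE-POINTED — the SAME one genuine stub `stub_imcDivSomeFrameNotRamB`, the SAME certified
# rung `stub_rung_6615d1_d59`, and `_of` := `LowerHalfEndState.notRamRamFree_of_notRam` ∘ (v4's `OpenInputNotRam_of` body): the ram-free cut asks
# the open input only OFF «Surj ∧ E(ℚ_p)[p] = 0 ∧ ∃ odd non-split multiplicative q ≠ p» (those ¬(ram) pairs are served by the erratum road's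
# ram-free kernel, imc-p1 g32∕g33 p697406 ∕ p700734), and v4's composition gives the open input at EVERY ¬(ram) pair, a fortiori off that set.

THE CRUX (text of `Theorems/ErratumRoadFiveKernelLowerHalfRamFree.lean` §3 «19282‡», g33 p700734 l.147; RULING 107):
`∀ W p, ¬ Ram W p → ¬ (Surj W p ∧ (∀ P : E(ℚ_p), p • P = 0 → P = 0) ∧ (∃ q prime, q ≠ 2 ∧ q ≠ p ∧ Mult W q ∧ ¬ Split W q)) → P2OpenInputOnTreeAt W p`
— implied by 19282's text via `LowerHalfEndState.notRamRamFree_of_notRam` (bookkeeping), so this line is 19282's v4 line composed with that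
implication; the genuine open content is UNCHANGED (the oriented value-free atom on the ¬(ram) pairs). A sharper line that uses the smaller
domain (asking the atom only off the served set) is possible but not needed for registration; it would be a v2 of THIS file.

v4's header (kept for the record):
# BC3 birth skeleton — crux `ErratumRoadFive.OpenInputNotRam` (item stmt-BirchSwinnertonDyer-19282, the (¬ram) atom)
# v4 (bsd-stepL-imc-p1 g29, 2026-08-29, executing planner g44's RULING 93 (2) ∕ (4); v3B bsd-stepL-bdp g17, v2 planner g27, v1 planner g25):
# ONE GENUINE STUB. The citable fact leaf F1 `stub_nr_castellaPNewDisplay` (JIMJ18 Thms. 2.10–2.11) is now the ROUTE ITEM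
# `Theses.ErratumRoadFive.CastellaPNewDisplayInput` (aside stmt-BirchSwinnertonDyer-23913, ER5 rev 71) taken BY NAME as a binder of
# `OpenInputNotRam_of` (RULING 82 (b): «a printed theorem is an ITEM BY NAME, not a stub»); the print-shaped halves CTL₀ ∕ H1′ ∕ H2 and the
# ∀-frame H3ᴮ of v3B's first road are FOLDED into the value-free road (below), so the registered open content of the line is exactly the
# ORIENTED value-free atom `stub_imcDivSomeFrameNotRamB` on the (¬ram) pairs; the certified BC5 rung `stub_rung_6615d1_d59` is kept VERBATIM
# and — v2 (planner g45, 2026-08-29) — DISCHARGED BY NAME `:= Theorems.Rung6615d1.stub_rung_6615d1_d59 h331 hKo hidx` (landed module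
# `Theorems/ErratumRoadFiveOpenInputNotRamRung6615d1.lean`), so the registry lists ONE active stub; v1 kept it `sorry`-registered (no per-item landed inheritance).

WHY THE FOLD IS HONEST (every folded stub is a tree THEOREM from route items ∕ refereed named facts, by name, on the (¬ram) pairs):
* CTL₀ `stub_charTorsionNotRam` (torsion + characteristic valuation at `p`) ⟸ `PublishedInputsFive` conjuncts alone —
  `Theorems.….openInputNotRam_stub_charTorsionNotRam_of_facts` (GZK, newform, Poitou–Tate; imc-p1 g16,
  `Theorems/ErratumRoadFiveOpenInputNotRamStubCharTorsionOfFacts.lean`) and `…_of_thm331Mult` (JSW17 Thm. 3.3.1-mult = item 19626; seat nram2);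
  inside the value-free road the same control is `p2ControlUpperOnTreeAt_of_facts W p hKo hPT hEP`.
* H1′ `stub_bdpDatumNotRam` (an `R₀`-frame exists) ⟸ Hsieh 2014 Thm. A + BDP13 reciprocity, refereed named facts
  (`….openInputNotRam_stub_bdpDatumNotRam_of_hsieh2014_unrPeriod_of_bdp2013`, seat nram2 g2; semistable case from Cas18 Thm. 3.1,
  `…_of_castella2018_of_semistable`); in the value-free road the frame is PART of the ∃-atom and its value at `𝟙` comes from the JIMJ18
  display (`Rest3TorsionBranchB.imcDivIntFrameOnTreeB_of_imcDivSomeFrameB_of_pNew hJ`, bdp g16 p498588).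
* H2 `stub_bdpValueNotRam` (the value at `𝟙` at every `R₀`-frame) ⟸ JIMJ18 + GZK + newform
  (`….openInputNotRam_stub_bdpValueNotRam_of_pNew hB hGZK hnf`, `Theorems/ErratumRoadFiveOpenInputNotRamStubBdpValueNotRam.lean`).
* H3ᴮ `stub_imcDivNotRamB` (divisibility at EVERY `R₀`-frame) is the ∀-form of the SAME open content; given H1′ it implies the ∃-atom, and
  no printed or announced theorem supplies either on the (¬ram) pairs (family-A dictionary: `Theorems/ErratumRoadFiveOpenInputNotRamIMCDivStub.lean`,
  `stub_imcDivNotRam_iff_imcDivAllUnrFrames` ∕ `stub_imcDivNotRam_of_imcDivSomeFrame`). Registering the ∃-atom alone is the weaker, honest ask.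
(19282 v4 header, continued.) The v3B text of the four folded stubs and of the first composition (`CTL₀ → H1′ → H2 → H3ᴮ → OpenInputNotRam`, the general-`p` twin of
`Three.stepLAt_of_halves₃B`) is preserved in the tree history (crux-write of 2026-08-27T07:59:41Z, sha16 8df837c5a18a00d0) and in the cell mirror
`HOME/imc-p1/g29/OpenInputNotRam-birth-v3B-8df837c5a18a00d0.lean`; no Lean file imports a line file (the `Theorems/…OpenInputNotRamStub*.lean`
closers name the `Birth.stub_*` decls in docstrings only), so no consumer is affected.

Route `route-BirchSwinnertonDyer-ErratumRoadFive` (rung K2, closes `X11b.MultiplicativeRankOne`), cell `bsd-stepL`, planner `bsd-stepL-plan`;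
the (¬ram) restriction of planner g19/g23's registered MECHANISM skeleton of the parent `OpenInputIMC` (item 19061, now `aside` after the g24
split 19061 → 19270 ∕ 19282 ∕ 19624). Registered form: named stubs `stub_*` (sorries ONLY there), stub statements by name (`Statement.stub_*`
via `type_of%`), the composition `OpenInputNotRam_of` concluding the ROUTE DECL by name (sorry-free) over the stub statement and ROUTE ITEMS
taken as binders BY NAME (`PublishedInputsFive` 19066, `CastellaPNewDisplayInput` 23913 — exactly as `closes` takes them), and `OpenInputNotRam_proof`.

The crux: `¬ Ram W p → P2OpenInputOnTreeAt W p` — route p2's composite open input `(IMC≥) ∘ (BDP)` at the trivial character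
(`IMCLowerWaldspurgerOnTreeAt`) at every X11b pair `p ≥ 5`, `ρ̄` onto, WITHOUT an `E[p]`-ramified multiplicative prime `ℓ ≠ p` (so
`N = p · (additive part) · ∏ ℓ` with `p ∣ v_ℓ(Δ)` at every other multiplicative `ℓ`): the regime where NO level-raising ∕ Jochnowitz ∕
bipartite-Euler-system argument has an auxiliary prime (JSW17 §7.4.2, Cas18 Thm. A, SZ14 ♠(3), W. Zhang 2014 ♠ all require one) — outside
every printed and announced theorem. Skeleton (v4):
* `stub_imcDivSomeFrameNotRamB` — THE GENUINE STUB: the ORIENTED value-free atom (2.4)∃♭ᴮ `P2.IMCDivSomeFrameOnTreeB W p` (bsd-stepL-bdp g16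
  p498117: for every classical Heegner datum SOME BDP frame `(Ω_K, Ω_p, Q)` at `(ι′, 𝔭_{ι′})` with Castella's interpolation property has the ONE
  inclusion `Ch_Λ(X_ac(E[p^∞]) 𝔭bar)·𝓞_{ℂ_p}⟦T⟧ ⊆ (Q)` at every X-slot `𝔭bar ≠ 𝔭_{ι′}`), asked only on the (¬ram) pairs. No road in print;
  ROAD B12 (λ-matching transfer, bdp g17 p507771; by-name resolution into UB|¬ram + INV|¬ram + {Hsieh14, BDP13}:
  `Theorems.….openInputNotRam_stub_imcDivSomeFrameNotRamB_of_facts_of_ratUpperBound_of_invariantsMatch`, second line `Lines/lambdaMatching.lean`)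
  concludes EXACTLY this atom.
* (no second stub) items BY NAME: `PublishedInputsFive` (19066: newform existence `hnf`, GZK `hGZK`, Kolyvagin `hKo`, Poitou–Tate `hPT`, local
  Euler–Poincaré `hEP` are the conjuncts used) and `CastellaPNewDisplayInput` (23913 = `Castella2018Exceptional.thm210_thm211_bdpDisplay_pNew`,
  unfolds definitionally).
* `stub_rung_6615d1_d59` — the certified PER-FIELD BC5 rung (T3) at `(6615d1, 5)` over `ℚ(√−59)` (imc-p1 g6; data below), VERBATIM; closed BY
  NAME (p461914); not used by `OpenInputNotRam_of`.
* `OpenInputNotRam_of` — the kernel-checked composition (sorry-free) = v3B's `OpenInputNotRam_of_atomB` with the F1 leaf replaced by the item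
  binder `hJ`: bsd-stepL-bdp g16's oriented T = 0 passage `Rest3TorsionBranchB.openInputOnTreeAt_of_imcDivSomeFrameB_of_pNew` (p498588;
  control from `hKo hPT hEP`, frame value from the JIMJ18 display, logarithm moved between the two embeddings in rank one).
No summit statement and no crux is proved here; BSD is not advanced by this file.
[cite: Castella2018, Thms. 2.3, 3.1, 3.2] [cite: Castella2018Exceptional, Thms. 2.10–2.11] [cite: JetchevSkinnerWan2017, Thm. 3.3.1, §7.4.2]
[cite: Castella2018Erratum, (2.4) (p. 4)] [cite: Hsieh2014, Thm. A] [cite: FouquetWan2021, Thm. 4.41] [cite: SkinnerZhang2014, ♠ (3)]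
-/

-- D-0017: single-problem summit, the namespace repeats the problem name by design.
set_option linter.dupNamespace false

noncomputable section

open scoped Classical

open WeierstrassCurve NumberField IsDedekindDomain Field PowerSeries
  Literature.NumberTheory.EllipticCurves Literature.NumberTheory.EllipticCurves.ModularForms
  Literature.NumberTheory.EllipticCurves.Rank1Residual
  Literature.NumberTheory.EllipticCurves.JetchevSkinnerWan2017
  Literature.NumberTheory.GaloisRepresentations
  Summit.BirchSwinnertonDyer.Rank1Residual Summit.BirchSwinnertonDyer.Rank1Residual.X11b
  Summit.BirchSwinnertonDyer.Rank1Residual.X11b.AcSelmer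
  Summit.BirchSwinnertonDyer.Rank1Residual.X11b.Halves

namespace Summit.BirchSwinnertonDyer.BirchSwinnertonDyer.Cruxes.OpenInputNotRamRamFree.Birth

/- the crux `OpenInputNotRamRamFree` is the ROUTE decl `Summit.BirchSwinnertonDyer.BirchSwinnertonDyer.Theses.ErratumRoadFive.OpenInputNotRamRamFree` (imported), concluded BY NAME below. -/

/-! ## Registered stubs -/

/-- **stub (2.4)∃♭ᴮ on the (¬ram) pairs** — the ORIENTED value-free atom `P2.IMCDivSomeFrameOnTreeB W p` (bdp g16
p498117: ONE inclusion `Ch_Λ(X_ac 𝔭bar)·𝓞⟦T⟧ ⊆ (Q)` for SOME BDP frame at `(ι', 𝔭_{ι'})`, every `𝔭bar ≠ 𝔭_{ι'}`),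
asked only on the (¬ram) pairs. No road in print; ROAD B12 (λ-matching transfer, bdp g17 p507771
`P2.imcDivSomeFrameOnTreeB_of_unrFrame_of_ratUpperBound_of_invariantsMatch`: FRAME + one rational Euler-system
divisibility + matching invariants) concludes EXACTLY this atom. -/
theorem stub_imcDivSomeFrameNotRamB :
    ∀ (W : WeierstrassCurve ℚ) [W.IsElliptic] [W.IsGloballyMinimal] (p : ℕ) [Fact p.Prime],
      ¬ Literature.NumberTheory.EllipticCurves.Rank1Residual.Ram W p →
        Summit.BirchSwinnertonDyer.Rank1Residual.X11b.P2.IMCDivSomeFrameOnTreeB W p := by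
  sorry

/-! ## Stub statements by name -/

namespace Statement

/-- Statement of `stub_imcDivSomeFrameNotRamB` (the genuine stub: the oriented value-free atom on the (¬ram) pairs). -/
abbrev stub_imcDivSomeFrameNotRamB : Prop := type_of% @Birth.stub_imcDivSomeFrameNotRamB

end Statement

/-! ## The composition (sorry-free): the stub STATEMENT and the route items 19066 ∕ 23913 imply the crux, BY NAME -/

/-- **`OpenInputNotRamRamFree_of`** (v1 = 19282's v4 composition + `LowerHalfEndState.notRamRamFree_of_notRam`) — the RAM-FREE crux BY NAME
from the ORIENTED value-free atom on the (¬ram) pairs + the route's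
published-input support item `PublishedInputsFive` (19066: modularity ∕ newform existence, GZK, Kolyvagin, Poitou–Tate, local
Euler–Poincaré characteristic) + the route's JIMJ18 item `CastellaPNewDisplayInput` (aside 23913, unfolds definitionally to
`Castella2018Exceptional.thm210_thm211_bdpDisplay_pNew`): bsd-stepL-bdp g16's oriented T = 0 passage
`Rest3TorsionBranchB.openInputOnTreeAt_of_imcDivSomeFrameB_of_pNew` (p498588) — one-sided control `P2ControlUpperOnTreeAt` from
`hKo hPT hEP` gives the valuation at the X-slot prime `𝔭`; the ∃-frame sits at the conjugate prime `𝔭′ = 𝔭_{ι′}`, its value at `𝟙` is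
read off the JIMJ18 continuity display (one-sided ♭-rigidity), the divisibility conjunct is read at `𝔭bar := 𝔭`, and the logarithm is
moved from `embAt 𝔭′` to `embAt 𝔭` in rank one (GZK) — this gives 19282's text at every ¬(ram) pair; then the ram-free cut by
`LowerHalfEndState.notRamRamFree_of_notRam` (g33, p700734). Pure composition.
[cite: Castella2018Exceptional, Thms. 2.10–2.11 (arXiv:1507.04260 pp. 13–14)] [cite: Castella2018Erratum, (2.4) (p. 4)]
[cite: Castella2018, Thms. 2.3, 3.1, 3.2, §5 (arXiv:1704.06608 pp. 5, 9, 12)] [cite: MilneADT2006, Ch. I, Thm. 4.10(b) and Thm. 2.8] -/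
theorem OpenInputNotRamRamFree_of
    (hF : Summit.BirchSwinnertonDyer.BirchSwinnertonDyer.Theses.ErratumRoadFive.PublishedInputsFive)
    (hJ : Summit.BirchSwinnertonDyer.BirchSwinnertonDyer.Theses.ErratumRoadFive.CastellaPNewDisplayInput)
    (h1 : Statement.stub_imcDivSomeFrameNotRamB) :
    Summit.BirchSwinnertonDyer.BirchSwinnertonDyer.Theses.ErratumRoadFive.OpenInputNotRamRamFree := by
  obtain ⟨-, hKo, -, -, -, hGZK, -, hnf, -, -, -, -, -, hPT, hEP⟩ := hF
  -- 19282's text at EVERY ¬(ram) pair (v4's composition, verbatim)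
  have hNR : ∀ (W : WeierstrassCurve ℚ) [W.IsElliptic] [W.IsGloballyMinimal] (p : ℕ) [Fact p.Prime],
      ¬ Literature.NumberTheory.EllipticCurves.Rank1Residual.Ram W p →
        Summit.BirchSwinnertonDyer.Rank1Residual.X11b.P2OpenInputOnTreeAt W p := fun W _ _ p _ hnr ↦
    Summit.BirchSwinnertonDyer.BirchSwinnertonDyer.Theorems.Rest3TorsionBranchB.openInputOnTreeAt_of_imcDivSomeFrameB_of_pNew
      hnf hGZK hKo hPT hEP hJ (h1 W p hnr)
  -- the ram-free cut is the weaker demand: the extra hypothesis is simply discarded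
  -- (= `LowerHalfEndState.notRamRamFree_of_notRam hNR`, g33 p700734; written with `intros` so that it does not depend on the
  -- bracketing of the minted middle hypothesis)
  unfold Summit.BirchSwinnertonDyer.BirchSwinnertonDyer.Theses.ErratumRoadFive.OpenInputNotRamRamFree
  intro W _ _ p _ hnr
  intros
  exact hNR W p hnr

/-- The ram-free crux along this line — v1: MODULO the route items 19066 ∕ 23913 (binders, exactly as `closes` takes them) and exactly the ONE
registered genuine stub (the only `sorry` used lives in `stub_imcDivSomeFrameNotRamB`; the rung's `sorry` is not used here and is closed
by name in `Theorems/`). -/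
theorem OpenInputNotRamRamFree_proof
    (hF : Summit.BirchSwinnertonDyer.BirchSwinnertonDyer.Theses.ErratumRoadFive.PublishedInputsFive)
    (hJ : Summit.BirchSwinnertonDyer.BirchSwinnertonDyer.Theses.ErratumRoadFive.CastellaPNewDisplayInput) :
    Summit.BirchSwinnertonDyer.BirchSwinnertonDyer.Theses.ErratumRoadFive.OpenInputNotRamRamFree :=
  OpenInputNotRamRamFree_of hF hJ stub_imcDivSomeFrameNotRamB

/-! ### BC5 PLAN-ONLY rung (T3-plan-only) — RE-SELECTED by planner g23 (2026-08-26); RE-HOMED to crux 19282 by planner g25 (judge j-addendum-2 ask (2))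
The g19 rung pair `(605c1, 5)` is WITHDRAWN as the T3 witness: `N = 605 < 5000`, so BSD₅(605c1) — indeed full
BSD for 605c1 — is a PRINTED THEOREM (Miller 2011, LMS J. Comput. Math. 14, Thm 1.2 ∕ Thm 7.7: rank ≤ 1, `N < 5000`,
`E[p]` irreducible ⇒ BSD(E,p) [arXiv:1010.2431]; Creutz–Miller 2012, J. Algebra 372, Thm 1.1: full BSD for every
`E/ℚ` with `N < 5000` and `r_an ≤ 1` [arXiv:1105.4018]; gaps re-closed by Lawson–Wuthrich [arXiv:1505.02940 §5]);
a rung inside S's printed regime is not a witness of weakness. The same applies to every candidate of the g19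
table with `N < 5000` (605a1, 605c1, 1080i1, 1215j1, 1960e1, 2160j1, 2160k1, 2645c1, 3024v1@7, 3920l1, 3920n1).
NEW rung pair `(6615d1, 5)`: Cremona minimal a-invariants `[1,-1,1,-167,816]`, `N = 6615 = 3³·5·7²` (≥ 5000:
outside Miller ∕ Creutz–Miller; additive at 3 and 7, NO multiplicative prime other than 5 ⇒ `¬ Ram W 5`),
`Δ_min = 3⁵·5⁵·7²`, `5 ∤ c₄ = 8001` ⇒ multiplicative at 5, `a₅ = +1` split, Kodaira I₅, `c₅ = 5` (so `5 ∣ c₅`: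
off the sharp per-curve Kolyvagin certificate and outside SZ14's `p ∤ ord_pΔ`), analytic rank 1
(`L′(E,1) ≈ 2.69968`), torsion 1, `Ш_an = 1.00`, generator `P = (−4, 39)`, `ĥ_∞(P) ≈ 0.0894326` (Cremona allbsd ∕
allgens); cyclotomic 5-adic regulator `ellpadicregulator(E,5,10,[P]) = 2 + 2·5 + 5² + 4·5³ + … ` a 5-adic UNIT (cell
kit batch j245265, `plan/D0059/bc5-rung-regulators-all.tsv`) ⇒ the instance is non-degenerate. Surjectivity of
`ρ̄_{6615d1,5}` by Serre's criterion from good Frobenius traces (planner g23 recomputation): ℓ = 17, `a₁₇ = −1`: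
trace ≢ 0, `a² − 4ℓ ≡ 3` non-square mod 5 ⇒ irreducible element (not Borel ∕ N(C_s)); ℓ = 13, `a₁₃ = −6`: trace ≢ 0,
`a² − 4ℓ ≡ 4` a non-zero square ⇒ not N(C_ns); ℓ = 17: `u = a²/ℓ ≡ 3 ∉ {0,1,2,4}`, `u² − 3u + 1 ≡ 1 ≢ 0` ⇒ not
exceptional — so the `Surj` hypothesis inside `P2OpenInputOnTreeAt` holds and the instance is NOT vacuous. Why it
lies outside S's known regime: no class-wide printed theorem reaches `p ∥ N ∧ ¬(ram) ∧ p ∣ c_p` (JSW17 §7.4,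
Cas18 Thm A + erratum, SZ14 Thm 1.1, W. Zhang 2014 all excluded — BC9 of the route) and no per-curve printed
verification reaches `N ≥ 5000`. Substitutes of the same shape with `N ≥ 5000` and certified non-zero regulator
(same batch): 6615i1@5, 8640y1@5, 8640bm1@5, 10890cc1@5, 5600t1@7, 11200ck1@7. Technique for the rung (unchanged):
certified anticyclotomic BDP computation at one admissible `(K, 𝔭)` plus the tree's frame
`imcLowerWaldspurgerOnTreeAt_of_value_of_dvd`; first prover target of the K2 hands (imc-p1). -/

/-- The curve 6615d1 (Cremona minimal model). -/
def W6615d1 : WeierstrassCurve ℚ := ⟨1, -1, 1, -167, 816⟩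

/-- **stub (BC5 rung, v2 = PER-FIELD, certified; imc-p1 g6 2026-08-26, registered by planner g27)**: the (ram)-free IMC lower-half
input of the single pair `(6615d1, 5)` at EVERY classical Heegner datum over the ONE field `K₀ = ℚ(√−59)` (binder `NumberField.discr K = -59`),
displayed over the published facts JSW17 Thm 3.3.1-mult (`h331`) + Kolyvagin (`hKo`) and the ATTESTED index certificate `hidx`
(kit j257035: `ord₅ [E(K₀) : ℤ y_{K₀}] = 1`, read through any parametrisation datum with `5 ∤ c`). WHY v2: the g23/g25 ∀-K rung
`stub_rung_6615d1 : P2OpenInputOnTreeAt W6615d1 5` is NOT certifiable — at a ¬(ram) pair the open input at K contains the rank-0 lower bound for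
the ¬(ram) twist `E^{d_K}` for infinitely many `K` and no refereed theorem or finite certificate gives it (imc-p1 g6, `RUNG-19282-6615d1-imc-p1-g6.md`
§1; judge direction (c) on 19282: «an explicit-K instance WITH content»). The v2 text is closed BY NAME by the landed
`Summit.BirchSwinnertonDyer.BirchSwinnertonDyer.Theorems.Rung6615d1.rung_6615d1_d59_of_cert h331 hKo hidx` (p461914 ✓). Why it lies outside S's
known regime: `N = 6615 ≥ 5000` (outside Miller ∕ Creutz–Miller), `p = 5 ∥ N`, ¬(ram), `5 ∣ c₅`, `E(ℚ₅)[5] ≠ 0` — no class-wide printed theorem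
(JSW17 §7.4, Cas18 Thm A + erratum, SZ14 Thm 1.1, W. Zhang 2014 all excluded; BC9 of the route). HONEST CONTENT: at `K₀` the inequality unfolds to
`0 ≤ ord₅ #Ш(E/K₀)[5^∞]` (the Tamagawa exponent is spent on the index); it exercises the JSW control identity + the index certificate at a split
`p ∣ c_p` ¬(ram) pair and says nothing about the pair's other Heegner fields (the genuine content of the crux). Not used by `OpenInputNotRamRamFree_of`. -/
theorem stub_rung_6615d1_d59
    [(⟨1, -1, 1, -167, 816⟩ : WeierstrassCurve ℚ).IsElliptic] [(⟨1, -1, 1, -167, 816⟩ : WeierstrassCurve ℚ).IsGloballyMinimal]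
    (h331 : thm331_anticyclotomicControl_mult)
    (hKo : ∀ (N : ℕ) [NeZero N] (W : WeierstrassCurve ℚ) (K : Type) [Field K] [NumberField K], kolyvagin N W K)
    (hidx : ∀ (N : ℕ) [NeZero N] (K : Type) [Field K] [NumberField K]
      (Dt : ModularParametrizationData (⟨1, -1, 1, -167, 816⟩ : WeierstrassCurve ℚ) N)
      (H : HeegnerDatum N (NumberField.discr K)) (ι : K →+* ℂ)
      (P : ((⟨1, -1, 1, -167, 816⟩ : WeierstrassCurve ℚ).baseChange K).toAffine.Point),
      (⟨1, -1, 1, -167, 816⟩ : WeierstrassCurve ℚ).conductorNorm ℤ = N → NumberField.discr K = -59 →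
      WeierstrassCurve.Affine.Point.map ι.toRatAlgHom P = heegnerPointComplex Dt H → ¬ (5 : ℤ) ∣ Dt.c →
      padicValNat 5 (AddSubgroup.zmultiples P).index ≤ 1) :
    ∀ (N : ℕ) [NeZero N] (K : Type) [Field K] [NumberField K]
      (Dt : ModularParametrizationData (⟨1, -1, 1, -167, 816⟩ : WeierstrassCurve ℚ) N)
      (H : HeegnerDatum N (NumberField.discr K)) (ι : K →+* ℂ)
      (P : ((⟨1, -1, 1, -167, 816⟩ : WeierstrassCurve ℚ).baseChange K).toAffine.Point),
      ClassX11b (⟨1, -1, 1, -167, 816⟩ : WeierstrassCurve ℚ) 5 → 5 ≤ 5 →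
      Surj (⟨1, -1, 1, -167, 816⟩ : WeierstrassCurve ℚ) 5 →
      (⟨1, -1, 1, -167, 816⟩ : WeierstrassCurve ℚ).conductorNorm ℤ = N → IsImaginaryQuadratic K →
      Odd (NumberField.discr K) → ¬ (5 : ℤ) ∣ NumberField.discr K → ¬ 5 ∣ Units.torsionOrder K →
      SatisfiesHeegnerHypothesis N K →
      ((⟨1, -1, 1, -167, 816⟩ : WeierstrassCurve ℚ).quadraticTwist (NumberField.discr K : ℚ)).entireLFunction 1 ≠ 0 →
      WeierstrassCurve.Affine.Point.map ι.toRatAlgHom P = heegnerPointComplex Dt H →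
      ¬ (5 : ℤ) ∣ Dt.c → ¬ IsOfFinAddOrder P → NumberField.discr K = -59 →
      ∀ (κ : ZpExtension K 5), κ.IsAnticyclotomic →
        ∀ (γ : Field.absoluteGaloisGroup K) [Fact (κ.IsTopGenerator γ)]
          (𝔭 : HeightOneSpectrum (𝓞 K)) (h𝔭 : ((5 : ℕ) : 𝓞 K) ∈ 𝔭.asIdeal)
          (he : 𝔭.asIdeal.ramificationIdx (𝓞 ℚ) = 1) (hf : 𝔭.asIdeal.inertiaDeg (𝓞 ℚ) = 1),
          IMCLowerWaldspurgerOnTreeAt 5 κ 𝔭 γ (embAt K 5 𝔭 h𝔭 he hf) P :=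
  -- v2 (planner g45, 2026-08-29): the certified rung is DISCHARGED BY NAME (landed p466071, module
  -- `Theorems/ErratumRoadFiveOpenInputNotRamRung6615d1.lean`); statement above byte-identical to v1 / 19282 v4.
  Summit.BirchSwinnertonDyer.BirchSwinnertonDyer.Theorems.Rung6615d1.stub_rung_6615d1_d59 h331 hKo hidx

namespace Statement

/-- Statement of `stub_rung_6615d1_d59` (certified per-field BC5 rung; not used by `OpenInputNotRamRamFree_of`). -/
abbrev stub_rung_6615d1_d59 : Prop := type_of% @Birth.stub_rung_6615d1_d59

end Statement

end Summit.BirchSwinnertonDyer.BirchSwinnertonDyer.Cruxes.OpenInputNotRamRamFree.Birth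

end
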